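import Summits.QuantumFields.QCD.Theses.HeatSlicedQuarks
import Summits.QuantumFields.QCD.Theorems.HeatSlicedQuarksSmallFieldUltracontractivity
import Summits.QuantumFields.QCD.Theorems.HeatSlicedQuarksInterleavedHeatSliceFlowStubColumnIdentificationAux
import Summits.QuantumFields.QCD.Theorems.HeatSlicedQuarksSmallFieldUltracontractivityFixedPointA
import Summits.QuantumFields.QCD.Theorems.HeatSlicedQuarksInterleavedHeatSliceFlowStubGramRepresentation
import Summits.QuantumFields.QCD.Theorems.HeatSlicedQuarksInterleavedHeatSliceFlowStubColumnSmoothing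
import Summits.QuantumFields.QCD.Theorems.HeatSlicedQuarksInterleavedHeatSliceFlowStubGammaFiveDiagonal
import Summits.QuantumFields.QCD.Theorems.HeatSlicedQuarksInterleavedHeatSliceFlowStubColumnIntegral
import Summits.QuantumFields.QCD.Theorems.HeatSlicedQuarksInterleavedHeatSliceFlowSlicedGramBound

/-!
# Stub `stub_sliceGramForm` of line `Sketch` (crux `InterleavedHeatSliceFlow`, item stmt-QuantumFields-8891,
# reshape r7, wave 2): the GRAM FORM of the heat-slice quark covariance with background-free norm bounds

With `D = D_W(U,m,1)` (Wilson–Dirac, fundamental SU(3), Wilson parameter `1`), `H = DᴴD`, `K(t) = e^{-tH}`,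
the heat-slice quark covariance is `C_{a,b}(U)(ξ,η) = ∫_a^b (K(t) Dᴴ)(ξ,η) dt`.  This file proves the
interface the fermionic tree expansions (Gawędzki–Kupiainen / Feldman–Magnen–Rivasseau–Sénéor slice
integrations) consume: for `2 ≤ a ≤ b ≤ r²` there are vectors `f_ξ, g_η ∈ ℓ²(Λ × 3 × 4)` with

* `C_{a,b}(U)(ξ,η) = ⟪f_ξ, g_η⟫` for ALL `ξ, η` (no smallness needed), and
* `‖f_ξ‖ ≤ C/a`, `‖g_η‖ ≤ C/√a` whenever the site of `ξ` (resp. `η`) is the centre of a `K·r`-ball of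
  `(ε/r²)²`-small plaquettes,

with `ε, K` the constants of `SmallFieldUltracontractivity_of` (item 8871, PROVED) and `C = 3 √(max C₀ 0)`.

## Construction and proof

* `f_ξ := col_ξ K(a/2)` and `g_η := col_η ∫_a^b K(t - a/2) Dᴴ dt`.
* Identity (`gramForm_integral_eq_inner`): the landed `stub_gramRepresentation` at `s = a/2` gives
  `C(ξ,η) = Σ_ζ K(a/2)(ξ,ζ) G(ζ,η)`, and hermiticity of `K(a/2)` (`isHermitian_exp_neg_smul`) turns the
  `ℓ²` inner product `Σ_ζ conj(K(a/2)(ζ,ξ)) G(ζ,η)` into exactly this sum (landed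
  `inner_toLp_col_eq_sum_of_isHermitian` of the sliced Gram bound file, p141956).
* `‖f_ξ‖² = Re K(a)(ξ,ξ) ≤ C₁/a²` (landed `sum_norm_sq_col_eq_re_apply_self` + SFU at `t = a`), so
  `‖f_ξ‖ ≤ √C₁/a` (`gramForm_norm_col_le`).
* `‖g_η‖ ≤ 2√2 √(C₁/e)/√a` (`gramForm_norm_integral_col_le`): for `a ≤ t ≤ b`, `σ = t - a/2 ∈ [1, r²]`,
  column smoothing (`stub_columnSmoothing`), the `γ₅` diagonal identity (`stub_gammaFiveDiagonal`) and SFU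
  at time `σ` give `‖col_η (K(σ)Dᴴ)‖₂ ≤ √(C₁/e)/(σ√σ)`; then Minkowski in time (`stub_columnIntegral`).
* Constants: `√C₁ ≤ 3√C₁` and `2√2 √(C₁/e) ≤ 2√2 √(C₁/2) = 2√C₁ ≤ 3√C₁` (`gramForm_smoothing_const_le`).
-/

noncomputable section

namespace Summit.QuantumFields.QCD.Cruxes.InterleavedHeatSliceFlow.Sketch

open Literature.MathematicalPhysics.QuantumLattice Literature.MathematicalPhysics.QuantumFieldTheory
  Literature.Probability.LatticeModels
open Summit.QuantumFields.QCD.Theses.HeatSlicedQuarks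
open Summit.QuantumFields.QCD.Theorems.SmallFieldUltracontractivity.Negative
open Summit.QuantumFields.QCD.Cruxes.SmallFieldUltracontractivity.PointCentredAxialParabolic
open MeasureTheory intervalIntegral
open scoped Matrix ComplexConjugate InnerProductSpace

/-! ### An elementary constant -/

/-- The elementary constant comparison `2√2 √(C/e) ≤ 3 √C` (via `2 ≤ e`: `2√2 √(C/e) ≤ 2√2 √(C/2) = 2√C`). -/
theorem gramForm_smoothing_const_le {C : ℝ} (hC : 0 ≤ C) :
    2 * Real.sqrt 2 * Real.sqrt (C / Real.exp 1) ≤ 3 * Real.sqrt C := by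
  have h2e : C / Real.exp 1 ≤ C / 2 :=
    div_le_div_of_nonneg_left hC two_pos (by linarith [Real.add_one_le_exp (1 : ℝ)])
  have hs : Real.sqrt 2 * Real.sqrt (C / 2) = Real.sqrt C := by
    rw [← Real.sqrt_mul (by norm_num : (0 : ℝ) ≤ 2)]
    congr 1
    ring
  calc 2 * Real.sqrt 2 * Real.sqrt (C / Real.exp 1)
      ≤ 2 * Real.sqrt 2 * Real.sqrt (C / 2) :=
        mul_le_mul_of_nonneg_left (Real.sqrt_le_sqrt h2e) (by positivity)
    _ = 2 * Real.sqrt C := by rw [mul_assoc, hs]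
    _ ≤ 3 * Real.sqrt C := by linarith [Real.sqrt_nonneg C]

/-! ### The Gram form for a general matrix `A` -/

/-- **Gram identity** (any complex square matrix `A`, all real `a, b`, all entries): with `H = AᴴA`,
`∫_a^b (e^{-tH} Aᴴ)(ξ,η) dt = ⟪col_ξ e^{-(a/2)H}, col_η ∫_a^b e^{-(t-a/2)H} Aᴴ dt⟫_{ℓ²}` — the landed
`stub_gramRepresentation` at `s = a/2` plus hermiticity of `e^{-(a/2)H}`. -/
theorem gramForm_integral_eq_inner {ι : Type} [Fintype ι] [DecidableEq ι] (A : Matrix ι ι ℂ)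
    (a b : ℝ) (ξ η : ι) :
    (∫ t in a..b, (NormedSpace.exp (-(t : ℂ) • (Aᴴ * A)) * Aᴴ) ξ η) =
      ⟪(WithLp.toLp 2 fun ζ => (NormedSpace.exp (-((a / 2 : ℝ) : ℂ) • (Aᴴ * A))) ζ ξ :
          EuclideanSpace ℂ ι),
        (WithLp.toLp 2 fun ζ => ∫ t in a..b,
            (NormedSpace.exp (-((t - a / 2 : ℝ) : ℂ) • (Aᴴ * A)) * Aᴴ) ζ η :
          EuclideanSpace ℂ ι)⟫_ℂ := by
  rw [inner_toLp_col_eq_sum_of_isHermitian (isHermitian_exp_neg_smul A (a / 2)),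
    stub_gramRepresentation ι A (a / 2) a b ξ η]

/-- **Norm of the left Gram vector**: `‖col_ξ e^{-(a/2)AᴴA}‖₂ = √(Re e^{-aAᴴA}(ξ,ξ)) ≤ √C₁/a` as soon as
`|e^{-aAᴴA}(ξ,ξ)| ≤ C₁/a²` (`0 < a`). -/
theorem gramForm_norm_col_le {ι : Type} [Fintype ι] [DecidableEq ι] (A : Matrix ι ι ℂ) {a C₁ : ℝ}
    (ha : 0 < a) (ξ : ι)
    (hξ : ‖(NormedSpace.exp (-(a : ℂ) • (Aᴴ * A))) ξ ξ‖ ≤ C₁ / a ^ 2) :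
    ‖(WithLp.toLp 2 fun ζ => (NormedSpace.exp (-((a / 2 : ℝ) : ℂ) • (Aᴴ * A))) ζ ξ :
        EuclideanSpace ℂ ι)‖ ≤ Real.sqrt C₁ / a := by
  rw [norm_toLp_two_eq_sqrt, sum_norm_sq_col_eq_re_apply_self A (a / 2) ξ]
  have h2a : (2 * (a / 2) : ℝ) = a := by ring
  rw [h2a]
  calc Real.sqrt ((NormedSpace.exp (-(a : ℂ) • (Aᴴ * A))) ξ ξ).re
      ≤ Real.sqrt (C₁ / a ^ 2) := Real.sqrt_le_sqrt ((Complex.re_le_norm _).trans hξ)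
    _ = Real.sqrt C₁ / a := by rw [Real.sqrt_div' C₁ (sq_nonneg a), Real.sqrt_sq ha.le]

/-- **Norm of the right Gram vector**: for `2 ≤ a ≤ b`, `0 ≤ C₁`, the diagonal identity
`e^{-tAAᴴ}(η,η) = e^{-tAᴴA}(η,η)` and the diagonal heat-kernel bound `|e^{-tAᴴA}(η,η)| ≤ C₁/t²` on
`1 ≤ t ≤ b`, the column `η` of `∫_a^b e^{-(t-a/2)AᴴA} Aᴴ dt` has `ℓ²` norm `≤ 2√2 √(C₁/e)/√a`
(column smoothing at `σ = t - a/2 ∈ [1, b]`, then Minkowski in time). -/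
theorem gramForm_norm_integral_col_le {ι : Type} [Fintype ι] [DecidableEq ι] (A : Matrix ι ι ℂ)
    {a b C₁ : ℝ} (ha : 2 ≤ a) (hab : a ≤ b) (hC₁ : 0 ≤ C₁) (η : ι)
    (hdiag : ∀ t : ℝ,
      (NormedSpace.exp (-(t : ℂ) • (A * Aᴴ))) η η = (NormedSpace.exp (-(t : ℂ) • (Aᴴ * A))) η η)
    (hη : ∀ t : ℝ, 1 ≤ t → t ≤ b →
      ‖(NormedSpace.exp (-(t : ℂ) • (Aᴴ * A))) η η‖ ≤ C₁ / t ^ 2) :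
    ‖(WithLp.toLp 2 fun ζ => ∫ t in a..b,
        (NormedSpace.exp (-((t - a / 2 : ℝ) : ℂ) • (Aᴴ * A)) * Aᴴ) ζ η : EuclideanSpace ℂ ι)‖ ≤
      2 * Real.sqrt 2 * Real.sqrt (C₁ / Real.exp 1) / Real.sqrt a := by
  have ha0 : 0 < a := by linarith
  have he : 0 < Real.exp 1 := Real.exp_pos 1
  have hM0 : 0 ≤ Real.sqrt (C₁ / Real.exp 1) := Real.sqrt_nonneg _
  rw [norm_toLp_two_eq_sqrt]
  refine stub_columnIntegral ι (fun ζ => ∫ t in a..b,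
      (NormedSpace.exp (-((t - a / 2 : ℝ) : ℂ) • (Aᴴ * A)) * Aᴴ) ζ η)
    (fun t ζ => (NormedSpace.exp (-((t - a / 2 : ℝ) : ℂ) • (Aᴴ * A)) * Aᴴ) ζ η) a b
    (Real.sqrt (C₁ / Real.exp 1)) ha0 hab hM0 (fun q => rfl) (fun q => ?_) (fun t hat htb => ?_)
  · -- continuity of the integrand in `t` (matrix exponential in the `L^∞` operator normed algebra)
    open scoped Matrix.Norms.Operator in
    exact (((NormedSpace.exp_continuous.comp
      ((Complex.continuous_ofReal.comp (continuous_sub_right (a / 2))).neg.smul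
        continuous_const)).mul continuous_const).matrix_elem q η).continuousOn
  · -- pointwise bound at time `t`, `σ = t - a/2 ∈ [1, b]`
    set σ : ℝ := t - a / 2 with hσdef
    have hσ0 : 0 < σ := by rw [hσdef]; linarith
    have hσ1 : 1 ≤ σ := by rw [hσdef]; linarith
    have hσb : σ ≤ b := by rw [hσdef]; linarith
    have hS := stub_columnSmoothing ι A σ hσ0 η
    rw [hdiag σ] at hS
    have hre : ((NormedSpace.exp (-(σ : ℂ) • (Aᴴ * A))) η η).re ≤ C₁ / σ ^ 2 :=
      (Complex.re_le_norm _).trans (hη σ hσ1 hσb)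
    have hsum : ∑ ζ, ‖(NormedSpace.exp (-(σ : ℂ) • (Aᴴ * A)) * Aᴴ) ζ η‖ ^ 2 ≤
        (Real.exp 1 * σ)⁻¹ * (C₁ / σ ^ 2) :=
      hS.trans (mul_le_mul_of_nonneg_left hre (inv_nonneg.mpr (by positivity)))
    rw [Real.sqrt_le_iff]
    refine ⟨by positivity, hsum.trans (le_of_eq ?_)⟩
    rw [div_pow, mul_pow, Real.sq_sqrt hσ0.le, Real.sq_sqrt (div_nonneg hC₁ he.le)]
    field_simp

/-! ### The registered stub -/

/-- **Registered stub `stub_sliceGramForm` of line `Sketch` — the GRAM FORM of the heat-slice quark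
covariance with background-free norm bounds, a THEOREM.**  There are `ε > 0`, `K`, `C` (the `ε, K` of
`SmallFieldUltracontractivity_of`, item 8871, and `C = 3 √(max C₀ 0)`) such that for every torus side `L`,
SU(3) field `U`, bare mass `m ∈ [-1/2, 1]`, scale `1 ≤ r ≤ L` and heat slice `2 ≤ a ≤ b ≤ r²` there are
vectors `f_ξ, g_η ∈ ℓ²(Λ × 3 × 4)` with
`∫_a^b (e^{-tD_WᴴD_W} D_Wᴴ)(ξ,η) dt = ⟪f_ξ, g_η⟫` for ALL `ξ, η`, and `‖f_ξ‖ ≤ C/a`, `‖g_η‖ ≤ C/√a` whenever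
the site of `ξ` (resp. `η`) is the centre of a `K·r`-ball on which every plaquette deficit is `≤ (ε/r²)²`
(`f_ξ = col_ξ e^{-(a/2)H}`, `g_η = col_η ∫_a^b e^{-(t-a/2)H} D_Wᴴ dt`, `H = D_WᴴD_W`).  This is the interface
the GK/FMRS fermionic slice integrations consume (Gram–Hadamard then gives factorial-free determinant
bounds with background-independent constants).  Proof: `gramForm_integral_eq_inner`,
`gramForm_norm_col_le`, `gramForm_norm_integral_col_le` (fed with `stub_gammaFiveDiagonal`) and SFU. -/
theorem stub_sliceGramForm :
    ∃ ε : ℝ, 0 < ε ∧ ∃ K : ℕ, ∃ C : ℝ, ∀ (L : ℕ) [NeZero L]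
      (U : GaugeConfig 4 L (Matrix.specialUnitaryGroup (Fin 3) ℂ)) (m : ℝ), m ∈ Set.Icc (-(1 / 2 : ℝ)) 1 →
      ∀ (r : ℕ), 1 ≤ r → r ≤ L → ∀ (a b : ℝ), 2 ≤ a → a ≤ b → b ≤ (r : ℝ) ^ 2 →
      ∃ f g : TorusSite 4 L × Fin 3 × Fin 4 → EuclideanSpace ℂ (TorusSite 4 L × Fin 3 × Fin 4),
        (∀ ξ η : TorusSite 4 L × Fin 3 × Fin 4,
          (∫ t in a..b, ((NormedSpace.exp (-(t : ℂ) • ((wilsonDirac (fundamentalRep (Fin 3)) U m 1)ᴴ *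
              wilsonDirac (fundamentalRep (Fin 3)) U m 1)) *
            (wilsonDirac (fundamentalRep (Fin 3)) U m 1)ᴴ) ξ η)) = inner ℂ (f ξ) (g η)) ∧
        (∀ ξ : TorusSite 4 L × Fin 3 × Fin 4,
          (∀ y : TorusSite 4 L, torusDist ξ.1 y ≤ K * r → ∀ (μ ν : Fin 4),
            3 - ((fundamentalRep (Fin 3)) (plaquetteHolonomy U y μ ν)).trace.re ≤ (ε / (r : ℝ) ^ 2) ^ 2) →
          ‖f ξ‖ ≤ C / a) ∧
        (∀ η : TorusSite 4 L × Fin 3 × Fin 4,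
          (∀ y : TorusSite 4 L, torusDist η.1 y ≤ K * r → ∀ (μ ν : Fin 4),
            3 - ((fundamentalRep (Fin 3)) (plaquetteHolonomy U y μ ν)).trace.re ≤ (ε / (r : ℝ) ^ 2) ^ 2) →
          ‖g η‖ ≤ C / Real.sqrt a) := by
  obtain ⟨ε, hε, K, C₀, hSFU⟩ := SmallFieldUltracontractivity_of
  refine ⟨ε, hε, K, 3 * Real.sqrt (max C₀ 0), ?_⟩
  intro L _ U m hm r hr hrL a b ha hab hb
  have hC₁ : (0 : ℝ) ≤ max C₀ 0 := le_max_right _ _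
  have ha0 : 0 < a := by linarith
  have ha1 : (1 : ℝ) ≤ a := by linarith
  -- SFU (item 8871) at an admissible centre, colour–spin diagonal entries, constant `max C₀ 0`
  have hSFU' : ∀ p : TorusSite 4 L × Fin 3 × Fin 4,
      (∀ y : TorusSite 4 L, torusDist p.1 y ≤ K * r → ∀ μ ν : Fin 4,
        3 - ((fundamentalRep (Fin 3)) (plaquetteHolonomy U y μ ν)).trace.re ≤ (ε / (r : ℝ) ^ 2) ^ 2) →
      ∀ t : ℝ, 1 ≤ t → t ≤ b →
        ‖(NormedSpace.exp (-(t : ℂ) • ((wilsonDirac (fundamentalRep (Fin 3)) U m 1)ᴴ *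
            wilsonDirac (fundamentalRep (Fin 3)) U m 1))) p p‖ ≤ max C₀ 0 / t ^ 2 := by
    intro p hp t ht htb
    have h := hSFU L U m hm p.1 r hr hrL hp t ht (htb.trans hb) p.2.1 p.2.1 p.2.2 p.2.2
    exact h.trans (div_le_div_of_nonneg_right (le_max_left _ _) (by positivity))
  refine ⟨fun ξ => WithLp.toLp 2 fun ζ =>
      (NormedSpace.exp (-((a / 2 : ℝ) : ℂ) • ((wilsonDirac (fundamentalRep (Fin 3)) U m 1)ᴴ *
        wilsonDirac (fundamentalRep (Fin 3)) U m 1))) ζ ξ,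
    fun η => WithLp.toLp 2 fun ζ => ∫ t in a..b,
      (NormedSpace.exp (-((t - a / 2 : ℝ) : ℂ) • ((wilsonDirac (fundamentalRep (Fin 3)) U m 1)ᴴ *
          wilsonDirac (fundamentalRep (Fin 3)) U m 1)) *
        (wilsonDirac (fundamentalRep (Fin 3)) U m 1)ᴴ) ζ η,
    fun ξ η => gramForm_integral_eq_inner (wilsonDirac (fundamentalRep (Fin 3)) U m 1) a b ξ η,
    fun ξ hξ => ?_, fun η hη => ?_⟩
  · -- ‖f ξ‖ ≤ √C₁ / a ≤ 3 √C₁ / a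
    refine (gramForm_norm_col_le (wilsonDirac (fundamentalRep (Fin 3)) U m 1) ha0 ξ
      (hSFU' ξ hξ a ha1 hab)).trans ?_
    exact div_le_div_of_nonneg_right (by linarith [Real.sqrt_nonneg (max C₀ 0)]) ha0.le
  · -- ‖g η‖ ≤ 2√2 √(C₁/e) / √a ≤ 3 √C₁ / √a
    refine (gramForm_norm_integral_col_le (wilsonDirac (fundamentalRep (Fin 3)) U m 1) ha hab hC₁ η
      (fun t => stub_gammaFiveDiagonal L U m t η) (fun t ht htb => hSFU' η hη t ht htb)).trans ?_
    exact div_le_div_of_nonneg_right (gramForm_smoothing_const_le hC₁) (Real.sqrt_nonneg a)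

end Summit.QuantumFields.QCD.Cruxes.InterleavedHeatSliceFlow.Sketch

end
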